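import Literature.MathematicalPhysics.QuantumFieldTheory.CentralTwistFluxRemoval
import HarnessLib

/-!
# The strong-coupling vortex bound in the twist-tensor form of 't Hooft twisted boundary conditions
# (`QuantumLattice/TwistedBoundaryConditions.lean`): one unit of centre flux on one plane

Topic `Literature/MathematicalPhysics/QuantumFieldTheory`; vocabulary of `CentralTwistPolymers.lean` / `CentralTwistFluxRemoval.lean`
(namespace `CentralTwist`: `twistZ`, `cochainMul`, `pathCochain`, `one_sub_twistZ_div_le_of_central`) and of
`Literature/MathematicalPhysics/QuantumLattice/TwistedBoundaryConditions.lean` (namespace `QuantumLattice`: `Twist d G = Plane d →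
Z(G)`, `plaquetteTwist`, `twistedHolonomy z U p = z_p⁻¹ U_p`, `twistedWilsonAction`, `twistedPartitionFunction ρ z β : ℝ≥0∞` — the
González-Arroyo–Okawa "twist in the action" on the corner plaquettes `x_μ = x_ν = L - 1`; `suCenter`, `twistOfTensor N n`).
THEOREMS ONLY (no definition, no fact).

* `twistZ_sheetAt_eq_twistZ_vortexSheet` — for central `z` the twisted partition function does not depend on the position
  `(a, b)` of the sheet (arXiv:0707.2179 §4: the twist "can be moved … by the change of variables … leaving `Z_Λ` invariant";
  here by `cochainMul z (pathCochain L a b i j)`), whence `one_sub_twistZ_sheetAt_div_le_of_central`;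
* `plaquetteTwist_mulSingle` — a single-plane twist `mulSingle (i,j) ζ` twists exactly the sheet `𝒱_{-1,-1}`;
  `twistedPartitionFunction_toReal`, `twistedPartitionFunction_mulSingle_toReal` (`= e^{-Nβ#plaq} Z^{(𝒱_{-1,-1})}` with element
  `ζ⁻¹`), `twistedPartitionFunction_trivial_toReal`;
* ★ `one_sub_twistedPartitionFunction_mulSingle_div_le` — Ito–Seiler 2008 Thm 2.2 (1) in the twist-tensor form: for every
  second-countable compact `G`, continuous `ρ`, centre element `ζ` on one plane and `|β| ≤ 1/(4N (8(d-1)+1)² e²)`,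
  `1 - Z_ζ(β)/Z_1(β) ≤ 2d² L^{d-2} e^{-L²/2}`;
* ★ `sun_one_sub_twistedPartitionFunction_tensor_div_le` — `SU(N)`, twist tensor with one non-zero entry `n_{ij} = k`
  (`twistOfTensor_single`): the free energy of one unit of `Z_N` electric flux obeys the area law at strong coupling
  (K. R. Ito, E. Seiler, arXiv:0803.3019 [ItoSeiler2008Further] §2: "The analogous statement for `SU(N)` holds with `Z⁻` replaced
  by `Z^ω`"; G. 't Hooft, Nucl. Phys. B153 (1979) 141 [tHooft1979Flux] §2 (2.5)–(2.6)).

HONEST FRAMING: symmetric tori `(ℤ/Lℤ)^d`; a twist on ONE plane only (general twist tensors `n_{μν}` with several non-zero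
entries are not treated); strong coupling only.
-/

noncomputable section

open MeasureTheory Finset
open scoped BigOperators
open Literature.MathematicalPhysics.QuantumLattice
open Literature.Probability.LatticeModels (IsRConnected GeomInc Touches)

namespace Literature.MathematicalPhysics.QuantumFieldTheory

namespace CentralTwist

open Tomboulis2007

variable {d L : ℕ} {G : Type*} [Group G]

/-! ## The twist moved to any parallel sheet; the twist-tensor (corner-plaquette) form of the twisted partition function -/

section SheetTranslation

variable [TopologicalSpace G] [IsTopologicalGroup G] [CompactSpace G] [MeasurableSpace G] [BorelSpace G] [NeZero L]

/-- **The twisted partition function does not depend on the position of the sheet** (central `z`, any order): for every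
transverse position `(a, b)`, `Z^{(𝒱_{a,b})}_w = Z^{(𝒱_{0,0})}_w` — the change of variables along `pathCochain L a b i j`
(flux `[𝒱_{a,b}] - [𝒱_{0,0}]`) moves the twist (arXiv:0707.2179 §4, text after (4.1): the twist "can be moved to … any
other homologous coclosed set `𝒱'` by the change of variables … leaving `Z_Λ` invariant").
[cite: Tomboulis2007Confinement, §4 (text after eq. (4.1))] -/
theorem twistZ_sheetAt_eq_twistZ_vortexSheet {z : G} (hzc : ∀ g : G, z * g = g * z) (w : G → ℝ) {i j : Fin d}
    (hij : i < j) (a b : ZMod L) :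
    twistZ d L z w (sheetAt L a b i j hij) = twistZ d L z w (vortexSheet L i j hij) := by
  unfold twistZ
  have key : ∀ U : GaugeConfig d L G,
      (∏ p : Plaquette d L,
          (if p ∈ vortexSheet L i j hij then
              w (z * plaquetteHolonomy (cochainMul z (pathCochain L a b i j) U) p.1 p.2.1.1 p.2.1.2)
            else w (plaquetteHolonomy (cochainMul z (pathCochain L a b i j) U) p.1 p.2.1.1 p.2.1.2))) =
        ∏ p : Plaquette d L,
          (if p ∈ sheetAt L a b i j hij then w (z * plaquetteHolonomy U p.1 p.2.1.1 p.2.1.2)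
            else w (plaquetteHolonomy U p.1 p.2.1.1 p.2.1.2)) := by
    intro U
    refine Finset.prod_congr rfl fun p _ => ?_
    rw [plaquetteHolonomy_cochainMul hzc, fluxInt_pathCochain L a b hij, sheetAt_zero_zero hij]
    by_cases hp0 : p ∈ vortexSheet L i j hij
    · by_cases hp1 : p ∈ sheetAt L a b i j hij
      · rw [if_pos hp0, if_pos hp1, if_pos hp0, if_pos hp1, sub_self, zpow_zero, one_mul]
      · rw [if_pos hp0, if_neg hp1, if_pos hp0, if_neg hp1, zero_sub, zpow_neg, zpow_one, mul_inv_cancel_left]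
    · by_cases hp1 : p ∈ sheetAt L a b i j hij
      · rw [if_neg hp0, if_pos hp1, if_neg hp0, if_pos hp1, sub_zero, zpow_one]
      · rw [if_neg hp0, if_neg hp1, if_neg hp0, if_neg hp1, sub_self, zpow_zero, one_mul]
  calc ∫ U, ∏ p : Plaquette d L, (if p ∈ sheetAt L a b i j hij then w (z * plaquetteHolonomy U p.1 p.2.1.1 p.2.1.2)
            else w (plaquetteHolonomy U p.1 p.2.1.1 p.2.1.2)) ∂(Measure.pi fun _ : Edge d L => haarProbability G)
      = ∫ U, ∏ p : Plaquette d L,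
          (if p ∈ vortexSheet L i j hij then
              w (z * plaquetteHolonomy (cochainMul z (pathCochain L a b i j) U) p.1 p.2.1.1 p.2.1.2)
            else w (plaquetteHolonomy (cochainMul z (pathCochain L a b i j) U) p.1 p.2.1.1 p.2.1.2))
          ∂(Measure.pi fun _ : Edge d L => haarProbability G) := by
        congr 1
        funext U
        exact (key U).symm
    _ = ∫ U, ∏ p : Plaquette d L, (if p ∈ vortexSheet L i j hij then w (z * plaquetteHolonomy U p.1 p.2.1.1 p.2.1.2)
            else w (plaquetteHolonomy U p.1 p.2.1.1 p.2.1.2)) ∂(Measure.pi fun _ : Edge d L => haarProbability G) :=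
        integral_comp_cochainMul z (pathCochain L a b i j) (fun U => ∏ p : Plaquette d L,
          (if p ∈ vortexSheet L i j hij then w (z * plaquetteHolonomy U p.1 p.2.1.1 p.2.1.2)
            else w (plaquetteHolonomy U p.1 p.2.1.1 p.2.1.2)))

variable [SecondCountableTopology G]

/-- **The vortex bound with the twist on any parallel sheet** (central `z`, measurable weight in the Kotecký–Preiss region).
[cite: Tomboulis2007Confinement, §6.2 eqs. (6.10)–(6.14)] [cite: ItoSeiler2008Further, §2 Thm 2.2 (1)] -/
theorem one_sub_twistZ_sheetAt_div_le_of_central {z : G} (hzc : ∀ g : G, z * g = g * z)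
    {w : G → ℝ} (hw : Measurable w) {ε : ℝ} (hε : ∀ W, |w W - 1| ≤ ε)
    (hsmall : (((8 * (d - 1) : ℕ) : ℝ) + 1) ^ 2 * (Real.exp 2 * ε) ≤ 1 / 2) {i j : Fin d} (hij : i < j) (a b : ZMod L) :
    1 - twistZ d L z w (sheetAt L a b i j hij) / twistZ d L z w ∅ ≤
      2 * (d : ℝ) ^ 2 * (L : ℝ) ^ (d - 2) * Real.exp (-(1 / 2 * (L : ℝ) ^ 2)) := by
  rw [twistZ_sheetAt_eq_twistZ_vortexSheet hzc w hij a b]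
  exact one_sub_twistZ_div_le_of_central hzc hw hε hsmall hij

end SheetTranslation

/-! ### 't Hooft twists in the twist-tensor form of `QuantumLattice/TwistedBoundaryConditions.lean` -/

section TensorForm

variable {N : ℕ} [TopologicalSpace G] [IsTopologicalGroup G] [CompactSpace G] [MeasurableSpace G] [BorelSpace G]
  [NeZero L]

omit [TopologicalSpace G] [IsTopologicalGroup G] [CompactSpace G] [MeasurableSpace G] [BorelSpace G] in
/-- **A single-plane twist twists exactly the sheet `𝒱_{-1,-1}`**: for the twist `z = mulSingle q₀ ζ` (centre element `ζ`
on the plane `q₀ = (i, j)`, trivial on the other planes) the plaquette twist of `TwistedBoundaryConditions.lean` is `ζ` on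
the corner plaquettes `x_i = x_j = L - 1` of the `(i,j)`-planes and `1` elsewhere.
[cite: GarciaperezGonzalezarroyoOkawa2014, §6] -/
theorem plaquetteTwist_mulSingle (ζ : Subgroup.center G) {i j : Fin d} (hij : i < j) (p : Plaquette d L) :
    QuantumLattice.plaquetteTwist (Pi.mulSingle (⟨(i, j), hij⟩ : QuantumLattice.Plane d) ζ) p =
      if p ∈ sheetAt L (-1) (-1) i j hij then (ζ : G) else 1 := by
  obtain ⟨x, q⟩ := p
  unfold QuantumLattice.plaquetteTwist QuantumLattice.IsCornerPlaquette
  by_cases hq : q = ⟨(i, j), hij⟩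
  · subst hq
    rw [Pi.mulSingle_eq_same]
    by_cases h : x i = -1 ∧ x j = -1
    · have hm : (x, (⟨(i, j), hij⟩ : {p : Fin d × Fin d // p.1 < p.2})) ∈ sheetAt L (-1) (-1) i j hij :=
        mem_sheetAt.2 ⟨rfl, h⟩
      rw [if_pos hm]
      exact if_pos h
    · have hm : (x, (⟨(i, j), hij⟩ : {p : Fin d × Fin d // p.1 < p.2})) ∉ sheetAt L (-1) (-1) i j hij :=
        fun h' => h (mem_sheetAt.1 h').2
      rw [if_neg hm]
      exact if_neg h
  · rw [Pi.mulSingle_eq_of_ne hq, if_neg (fun h' => hq (mem_sheetAt.1 h').1)]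
    split_ifs <;> rfl

omit [TopologicalSpace G] [IsTopologicalGroup G] [CompactSpace G] [MeasurableSpace G] [BorelSpace G] in
/-- Pointwise form of the Wilson Gibbs factor with insertions (plumbing). [folklore] -/
private theorem exp_neg_mul_sum_eq_pow_mul_prod'' (β : ℝ) (t : Plaquette d L → ℝ) :
    Real.exp (-β * ∑ p : Plaquette d L, ((N : ℕ) - t p : ℝ)) =
      Real.exp (-(β * N)) ^ Fintype.card (Plaquette d L) * ∏ p : Plaquette d L, Real.exp (β * t p) := by
  rw [neg_mul, Finset.mul_sum, ← Finset.sum_neg_distrib, Real.exp_sum, ← Finset.card_univ, ← Finset.prod_const,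
    ← Finset.prod_mul_distrib]
  refine Finset.prod_congr rfl fun p _ => ?_
  rw [← Real.exp_add]
  congr 1
  ring

variable [SecondCountableTopology G]

omit [CompactSpace G] in
/-- The twisted Wilson action of the twist-tensor form is measurable in the configuration (continuous `ρ`). [folklore] -/
private theorem measurable_twistedWilsonAction (ρ : G →* Matrix (Fin N) (Fin N) ℂ) (hρ : Continuous ρ)
    (z : QuantumLattice.Twist d G) :
    Measurable fun U : GaugeConfig d L G => QuantumLattice.twistedWilsonAction ρ z U := by
  unfold QuantumLattice.twistedWilsonAction QuantumLattice.twistedHolonomy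
  refine Finset.measurable_sum _ fun p _ => measurable_const.sub ?_
  have hhol : Measurable fun U : GaugeConfig d L G => plaquetteHolonomy U p.1 p.2.1.1 p.2.1.2 := by
    unfold plaquetteHolonomy
    fun_prop
  exact (Complex.continuous_re.comp hρ.matrix_trace).measurable.comp (hhol.const_mul _)

/-- **The twist-tensor partition function as a real integral**: `Z_z(β).toReal = ∫ exp(-β S_z(U)) ∏ dU_e`.
[cite: tHooft1979Flux, §2 (2.6)] -/
theorem twistedPartitionFunction_toReal (ρ : G →* Matrix (Fin N) (Fin N) ℂ) (hρ : Continuous ρ)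
    (z : QuantumLattice.Twist d G) (β : ℝ) :
    (QuantumLattice.twistedPartitionFunction (L := L) ρ z β).toReal =
      ∫ U, Real.exp (-β * QuantumLattice.twistedWilsonAction ρ z U) ∂(Measure.pi fun _ : Edge d L => haarProbability G) := by
  unfold QuantumLattice.twistedPartitionFunction QuantumLattice.twistedWilsonWeight
  rw [withDensity_apply _ MeasurableSet.univ, Measure.restrict_univ,
    integral_eq_lintegral_of_nonneg_ae (ae_of_all _ fun U => (Real.exp_pos _).le)
      ((Real.measurable_exp.comp ((measurable_twistedWilsonAction ρ hρ z).const_mul _)).aestronglyMeasurable)]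

/-- **The single-plane 't Hooft twist in twist-tensor form is `e^{-Nβ#plaquettes} · Z^{(𝒱_{-1,-1})}` with twist element
`ζ⁻¹`** (the corner-plaquette factor `z_p⁻¹` of the González-Arroyo–Okawa action).
[cite: GarciaperezGonzalezarroyoOkawa2014, §6] [cite: tHooft1979Flux, §2 (2.6)] -/
theorem twistedPartitionFunction_mulSingle_toReal (ρ : G →* Matrix (Fin N) (Fin N) ℂ) (hρ : Continuous ρ)
    (ζ : Subgroup.center G) (β : ℝ) {i j : Fin d} (hij : i < j) :
    (QuantumLattice.twistedPartitionFunction (L := L) ρ (Pi.mulSingle (⟨(i, j), hij⟩ : QuantumLattice.Plane d) ζ) β).toReal =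
      Real.exp (-(β * N)) ^ Fintype.card (Plaquette d L) *
        twistZ d L ((ζ : G)⁻¹) (fun W => Real.exp (β * ((ρ W).trace).re)) (sheetAt L (-1) (-1) i j hij) := by
  rw [twistedPartitionFunction_toReal ρ hρ]
  unfold twistZ QuantumLattice.twistedWilsonAction QuantumLattice.twistedHolonomy
  rw [← integral_const_mul]
  congr 1
  funext U
  rw [exp_neg_mul_sum_eq_pow_mul_prod'']
  congr 1
  refine Finset.prod_congr rfl fun p _ => ?_
  rw [plaquetteTwist_mulSingle ζ hij p]
  by_cases hp : p ∈ sheetAt L (-1) (-1) i j hij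
  · rw [if_pos hp, if_pos hp]
  · rw [if_neg hp, if_neg hp, inv_one, one_mul]

/-- The trivial twist in twist-tensor form: `Z_1(β).toReal = e^{-Nβ#plaquettes} · Z_w` (any nominal twist element on the
empty sheet). [cite: tHooft1979Flux, §2 (2.6)] -/
theorem twistedPartitionFunction_trivial_toReal (ρ : G →* Matrix (Fin N) (Fin N) ℂ) (hρ : Continuous ρ) (z : G)
    (β : ℝ) :
    (QuantumLattice.twistedPartitionFunction (L := L) ρ (1 : QuantumLattice.Twist d G) β).toReal =
      Real.exp (-(β * N)) ^ Fintype.card (Plaquette d L) *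
        twistZ d L z (fun W => Real.exp (β * ((ρ W).trace).re)) ∅ := by
  rw [twistedPartitionFunction_toReal ρ hρ]
  unfold twistZ QuantumLattice.twistedWilsonAction
  rw [← integral_const_mul]
  congr 1
  funext U
  rw [exp_neg_mul_sum_eq_pow_mul_prod'']
  congr 1
  refine Finset.prod_congr rfl fun p _ => ?_
  rw [QuantumLattice.twistedHolonomy_one, if_neg (Finset.notMem_empty p)]

/-- **Ito–Seiler 2008 Theorem 2.2 (1) in the twist-tensor ('t Hooft twisted boundary conditions) form**, every compact gauge
group: for a continuous `ρ : G →* M_N(ℂ)`, a centre element `ζ` put on ONE plane `(i, j)` (twist `mulSingle (i,j) ζ` of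
`TwistedBoundaryConditions.lean`, corner plaquettes `x_i = x_j = L-1`) and `|β| ≤ 1/(4N (8(d-1)+1)² e²)`:
`1 - Z_{ζ}(β)/Z_{1}(β) ≤ 2d² L^{d-2} e^{-L²/2}` on every symmetric torus `(ℤ/Lℤ)^d`.
[cite: ItoSeiler2008Further, §2 Thm 2.2 (1)] [cite: tHooft1979Flux, §2 (2.6)] -/
theorem one_sub_twistedPartitionFunction_mulSingle_div_le (ρ : G →* Matrix (Fin N) (Fin N) ℂ) (hρ : Continuous ρ)
    (ζ : Subgroup.center G) {β : ℝ} (hβ : |β| ≤ 1 / (4 * N * ((((8 * (d - 1) : ℕ) : ℝ) + 1) ^ 2 * Real.exp 2)))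
    {i j : Fin d} (hij : i < j) :
    1 - (QuantumLattice.twistedPartitionFunction (L := L) ρ (Pi.mulSingle (⟨(i, j), hij⟩ : QuantumLattice.Plane d) ζ) β).toReal /
        (QuantumLattice.twistedPartitionFunction (L := L) ρ (1 : QuantumLattice.Twist d G) β).toReal ≤
      2 * (d : ℝ) ^ 2 * (L : ℝ) ^ (d - 2) * Real.exp (-(1 / 2 * (L : ℝ) ^ 2)) := by
  have hzc : ∀ g : G, (ζ : G)⁻¹ * g = g * (ζ : G)⁻¹ := fun g =>
    (Subgroup.mem_center_iff.1 (Subgroup.inv_mem _ ζ.2) g).symm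
  have hK : (1 : ℝ) ≤ (((8 * (d - 1) : ℕ) : ℝ) + 1) ^ 2 * Real.exp 2 := by
    have hD : (1 : ℝ) ≤ (((8 * (d - 1) : ℕ) : ℝ) + 1) ^ 2 := by
      have : (0 : ℝ) ≤ ((8 * (d - 1) : ℕ) : ℝ) := Nat.cast_nonneg _
      nlinarith
    have he : (1 : ℝ) ≤ Real.exp 2 := Real.one_le_exp (by norm_num)
    nlinarith
  have hNβ : (N : ℝ) * |β| * (4 * ((((8 * (d - 1) : ℕ) : ℝ) + 1) ^ 2 * Real.exp 2)) ≤ 1 := by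
    rcases Nat.eq_zero_or_pos N with hN | hN
    · simp [hN]
    · have hNpos : (0 : ℝ) < N := by exact_mod_cast hN
      have hden : (0 : ℝ) < 4 * N * ((((8 * (d - 1) : ℕ) : ℝ) + 1) ^ 2 * Real.exp 2) := by positivity
      have h := hβ
      rw [le_div_iff₀ hden] at h
      linarith
  have hNβ1 : (N : ℝ) * |β| ≤ 1 := by
    have : (N : ℝ) * |β| * 4 ≤ (N : ℝ) * |β| * (4 * ((((8 * (d - 1) : ℕ) : ℝ) + 1) ^ 2 * Real.exp 2)) := by
      have h0 : 0 ≤ (N : ℝ) * |β| := by positivity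
      nlinarith
    linarith
  have hε : ∀ W : G, |Real.exp (β * ((ρ W).trace).re) - 1| ≤ 2 * N * |β| :=
    abs_exp_mul_re_trace_sub_one_le ρ hρ hNβ1
  have hsmall : (((8 * (d - 1) : ℕ) : ℝ) + 1) ^ 2 * (Real.exp 2 * (2 * N * |β|)) ≤ 1 / 2 := by
    nlinarith [abs_nonneg β]
  rw [twistedPartitionFunction_mulSingle_toReal ρ hρ ζ β hij, twistedPartitionFunction_trivial_toReal ρ hρ ((ζ : G)⁻¹) β]
  have hpos : 0 < Real.exp (-(β * N)) ^ Fintype.card (Plaquette d L) := pow_pos (Real.exp_pos _) _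
  rw [mul_div_mul_left _ _ hpos.ne']
  exact one_sub_twistZ_sheetAt_div_le_of_central hzc (measurable_exp_mul_re_trace ρ hρ β) hε hsmall hij (-1) (-1)

end TensorForm

/-! ### `SU(N)`: one entry of the twist tensor `n_{μν}` -/

section SUNTensor

/-- The twist of a twist tensor supported on one plane is the single-plane twist by the corresponding centre element.
[cite: tHooft1979Flux, §2 (2.5)] -/
theorem twistOfTensor_single (N : ℕ) {i j : Fin d} (hij : i < j) (k : ZMod N) :
    QuantumLattice.twistOfTensor (d := d) N (Pi.single (⟨(i, j), hij⟩ : QuantumLattice.Plane d) k) =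
      Pi.mulSingle (⟨(i, j), hij⟩ : QuantumLattice.Plane d) (QuantumLattice.suCenter N k) := by
  funext q
  unfold QuantumLattice.twistOfTensor
  by_cases hq : q = ⟨(i, j), hij⟩
  · subst hq
    rw [Pi.single_eq_same, Pi.mulSingle_eq_same]
  · rw [Pi.single_eq_of_ne hq, Pi.mulSingle_eq_of_ne hq]
    have h0 : QuantumLattice.twistOfTensor (d := d) N 0 ⟨(i, j), hij⟩ = 1 := by
      rw [QuantumLattice.twistOfTensor_zero]; rfl
    exact h0

/-- **Ito–Seiler 2008 Theorem 2.2 (1), `SU(N)` twist-tensor form**: for the `SU(N)` theory with 't Hooft twisted boundary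
conditions of a twist tensor with a single non-zero entry `n_{ij} = k` (`twistOfTensor N (single (i,j) k)`, fundamental Wilson
action, `sunTwistedWilsonMeasure`'s partition function) and `|β| ≤ 1/(4N (8(d-1)+1)² e²)`:
`1 - Z_n(β)/Z_0(β) ≤ 2d² L^{d-2} e^{-L²/2}` on every symmetric torus `(ℤ/Lℤ)^d` — the electric-flux free energy of one unit
of `Z_N` flux obeys the area law at strong coupling. [cite: ItoSeiler2008Further, §2 Thm 2.2 (1) (text after the theorem)]
[cite: tHooft1979Flux, §2 (2.5)–(2.6)] -/
theorem sun_one_sub_twistedPartitionFunction_tensor_div_le (d N : ℕ) (k : ZMod N) {β : ℝ}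
    (hβ : |β| ≤ 1 / (4 * N * ((((8 * (d - 1) : ℕ) : ℝ) + 1) ^ 2 * Real.exp 2))) {L : ℕ} [NeZero L]
    {i j : Fin d} (hij : i < j) :
    1 - (QuantumLattice.twistedPartitionFunction (L := L) (fundamentalRep (Fin N))
            (QuantumLattice.twistOfTensor N (Pi.single (⟨(i, j), hij⟩ : QuantumLattice.Plane d) k)) β).toReal /
        (QuantumLattice.twistedPartitionFunction (L := L) (fundamentalRep (Fin N))
            (QuantumLattice.twistOfTensor (d := d) N 0) β).toReal ≤
      2 * (d : ℝ) ^ 2 * (L : ℝ) ^ (d - 2) * Real.exp (-(1 / 2 * (L : ℝ) ^ 2)) := by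
  haveI : SecondCountableTopology (Matrix (Fin N) (Fin N) ℂ) :=
    inferInstanceAs (SecondCountableTopology (Fin N → Fin N → ℂ))
  haveI : SecondCountableTopology (Matrix.specialUnitaryGroup (Fin N) ℂ) :=
    TopologicalSpace.Subtype.secondCountableTopology _
  rw [twistOfTensor_single, QuantumLattice.twistOfTensor_zero]
  exact one_sub_twistedPartitionFunction_mulSingle_div_le (fundamentalRep (Fin N)) (continuous_fundamentalRep (Fin N))
    (QuantumLattice.suCenter N k) hβ hij

end SUNTensor

end CentralTwist

end Literature.MathematicalPhysics.QuantumFieldTheory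

end
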